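import Literature.NumberTheory.GaloisRepresentations.ArchimedeanLocalDuality
import Literature.NumberTheory.EllipticCurves.ArchimedeanKummerImageMaximal
import Literature.NumberTheory.EllipticCurves.ArchimedeanWeilPairingDuality
import Literature.NumberTheory.EllipticCurves.CasselsTateLocalCupSymmetry
import Summits.BirchSwinnertonDyer.Rank1Residual.X11b.WeilTransport
import Literature.NumberTheory.GaloisCohomology.PoitouTateSelmerStructures
import HarnessLib

/-!
# Cassels' theorem from Poitou–Tate, archimedean input: `H²(K_w, μₙ)` has at most one non-zero class, so a
# local invariant map at an infinite place is `0` or injective; and in the injective case the dual of the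
# local Kummer condition (transported along the Weil pairing) IS the Kummer condition

Crux K4 `SignedControlAtTwo` (stmt-BirchSwinnertonDyer-20309; routes `ThetaPartnerAtTwo` /
`ResidualThetaTransportAtTwo`), line `eulerchar` v10, stub `stub_pubGreenbergPTTwo` = {Cassels, Prop. 4.12,
`poitouTate_selmerStructure_duality ℚ`}; width seat `prover-bsd-wall-tp2-p3-w3` g6 (Cassels lane).

The tree's Poitou–Tate fact `poitouTate_selmerStructure_duality K` constrains its family `inv` of local invariant
maps only at the FINITE places (`IsPerfect`); at a real place `w` nothing is asserted about
`inv_w : H²(K_w, μₙ) → ℤ/n` (cf. the sibling fact `poitouTate_selmerStructure_duality_real`, whose extra conjunct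
is `inv_w` injective). For Cassels' theorem over `ℚ` at `p = 2` the real place matters. This file shows that NO
extra conjunct is needed: by the explicit cohomology of a group of order `≤ 2` (Milne I Thm. 2.13, «can be proved
by direct calculation»), `H²(K_w, μₙ)` has AT MOST ONE non-zero class, so EVERY additive map out of it is either `0`
or injective (`addMonoidHom_galoisCohomology_two_mu_inl_eq_zero_or_injective`). In the first case the local term at
`w` of any Poitou–Tate sum vanishes outright; in the second, archimedean local duality (tree
`eq_zero_of_forall_cupProduct_pairing_eq_zero_infinitePlace`, Milne I Thm. 2.13(a)) and the maximal isotropy of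
the Kummer condition (tree `forall_mem_kummerSelmerStructure_weilCupProduct_eq_zero_iff_inl`) give the real-place
analogue of the X11b lemma `map_weilDualInv_mem_kummer_of_mem_dualLocalCondition`: the Weil transport of a class in
the dual local condition `𝓛_w^*` lies in `𝓛_w` (`map_weilDualInv_mem_kummer_of_mem_dualLocalCondition_inl`).

Contents: §1 groups of order `≤ 2` — `twoCocycleClass_eq_zero_of_forall_eq_one` (trivial group: `H² = 0`),
`twoCocycleClass_eq_zero_iff_of_natCard_le_two` (for `G = {1, c}` with `c` acting as `-1` on `Z`: `[φ] = 0 ↔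
φ(c,c) + φ(1,1) = 0`), `two_nsmul_add_eq_zero_of_natCard_le_two` (`2(φ(c,c) + φ(1,1)) = 0`),
`eq_of_ne_zero_of_natCard_le_two` (two non-zero classes of `H²(G, Z)` coincide if `Z[2]` has at most one
non-zero element); §2 the case `Z = μₙ`, `G = Γ_{K_w}` and the dichotomy; §4 the real-place right annihilator
(via the symmetry of the local Weil cup product).

THEOREMS ONLY (no definition, no named fact, no `sorry`); BSD is not proved by any of this.

References: [MilneADT2006] I Thm. 2.13(a) (p. 35), Example 1.6(c), Lemma 6.15; [SerreGaloisCohomology1997]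
I §2.3 (classes of factor systems), [NeukirchSchmidtWingberg2008] I §4 Prop. 1.4.4.
-/

set_option autoImplicit false
-- the Theorems namespace of this sub repeats the summit name by design (D-0017 nested layout)
set_option linter.dupNamespace false

noncomputable section

open scoped Classical

universe u v

open Field Function NumberField WeierstrassCurve
open Literature.NumberTheory.EllipticCurves Literature.NumberTheory.GaloisRepresentations
open Literature.NumberTheory.GaloisRepresentations.DiscreteGaloisModule (mu MuCarrier)
open Literature.NumberTheory.GaloisCohomology
open scoped ContRepresentation

namespace Summit.BirchSwinnertonDyer.BirchSwinnertonDyer.Theorems.SignedEC.CasselsPT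

/-! ## §1 Groups of order `≤ 2`: `H²` through the invariant `φ(c,c) + φ(1,1)` -/

section OrderTwo

open _root_.TopRep

variable {R : Type u} [CommRing R] [TopologicalSpace R]
variable {G : Type v} [Group G] [TopologicalSpace G] [IsTopologicalGroup G] [LocallyCompactSpace G]
variable {Z : TopRep.{v} R G}

/-- **`H²(1, Z) = 0`**: over the trivial group every continuous `2`-cocycle `φ` is the coboundary of the constant
`1`-cochain `φ(1,1)`. Serre, *Galois Cohomology*, I §2.3. [cite: SerreGaloisCohomology1997, I §2.3] -/
theorem twoCocycleClass_eq_zero_of_forall_eq_one (htriv : ∀ g : G, g = 1) (φ : contTwoCocycles Z) :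
    twoCocycleClass Z φ = 0 := by
  rw [twoCocycleClass_eq_zero_iff]
  refine ⟨ContinuousMap.const G (φ.1 (1, 1)), fun σ τ ↦ ?_⟩
  rw [htriv σ, htriv τ]
  simp only [ContinuousMap.const_apply, sub_add_cancel, _root_.map_one, one_apply_eq_self]

/-- **`H²` of a group `{1, c}` of order `2` on a module where `c` acts as `-1`: `[φ] = 0 ↔ φ(c,c) + φ(1,1) = 0`.**
(`→`: a coboundary `σ b(τ) - b(στ) + b(σ)` has `(1,1)`-value `b(1)` and `(c,c)`-value `-b(1)`; `←`: then `φ` is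
the coboundary of the constant cochain `φ(1,1)`, by the identities `φ(1,τ) = φ(1,1)`, `φ(σ,1) = σ φ(1,1)`.)
Milne, *ADT*, I Thm. 2.13 («can be proved by direct calculation»). [cite: MilneADT2006, Ch. I, Thm. 2.13] -/
theorem twoCocycleClass_eq_zero_iff_of_natCard_le_two [Finite G] (hG : Nat.card G ≤ 2) {c : G}
    (hc : c ≠ 1) (hZ : ∀ z : Z, Z.ρ c z = -z) (φ : contTwoCocycles Z) :
    twoCocycleClass Z φ = 0 ↔ φ.1 (c, c) + φ.1 (1, 1) = 0 := by
  constructor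
  · intro h
    rw [twoCocycleClass_eq_zero_iff] at h
    obtain ⟨b, hb⟩ := h
    have h11 := hb 1 1
    have hcc := hb c c
    rw [mul_one, _root_.map_one, one_apply_eq_self, sub_self, zero_add] at h11
    rw [mul_self_eq_one_of_natCard_le_two hG, hZ] at hcc
    rw [h11, hcc]
    abel
  · intro h
    rw [twoCocycleClass_eq_zero_iff]
    refine ⟨ContinuousMap.const G (φ.1 (1, 1)), fun σ τ ↦ ?_⟩
    simp only [ContinuousMap.const_apply, sub_add_cancel]
    rcases eq_or_ne σ 1 with rfl | hσ
    · rw [contTwoCocycles.apply_one_left, _root_.map_one, one_apply_eq_self]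
    · rw [eq_of_ne_one_of_natCard_le_two hG hσ hc]
      rcases eq_or_ne τ 1 with rfl | hτ
      · exact contTwoCocycles.apply_one_right φ c
      · rw [eq_of_ne_one_of_natCard_le_two hG hτ hc, hZ]
        exact eq_neg_of_add_eq_zero_left h

omit [IsTopologicalGroup G] [LocallyCompactSpace G] in
/-- The invariant `φ(c,c) + φ(1,1)` of a `2`-cocycle of `{1, c}` (`c` acting as `-1`) is killed by `2` (the
cocycle identity at `(c,c,c)`). [cite: MilneADT2006, Ch. I, Thm. 2.13] -/
theorem two_nsmul_add_eq_zero_of_natCard_le_two [Finite G] (hG : Nat.card G ≤ 2) {c : G}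
    (hZ : ∀ z : Z, Z.ρ c z = -z) (φ : contTwoCocycles Z) :
    2 • (φ.1 (c, c) + φ.1 (1, 1)) = 0 := by
  have h := φ.2 c c c
  rw [mul_self_eq_one_of_natCard_le_two hG, hZ, contTwoCocycles.apply_one_right φ c,
    contTwoCocycles.apply_one_left φ c, hZ] at h
  -- `h : -φ(c,c) + -φ(1,1) = φ(1,1) + φ(c,c)`
  rw [two_nsmul]
  calc φ.1 (c, c) + φ.1 (1, 1) + (φ.1 (c, c) + φ.1 (1, 1))
      = (φ.1 (1, 1) + φ.1 (c, c)) - (-φ.1 (c, c) + -φ.1 (1, 1)) := by abel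
    _ = 0 := by rw [← h, sub_self]

omit [IsTopologicalGroup G] [LocallyCompactSpace G] in
/-- The invariant is additive: `(φ - ψ)(c,c) + (φ - ψ)(1,1) = (φ(c,c) + φ(1,1)) - (ψ(c,c) + ψ(1,1))`. [folklore] -/
theorem sub_invariant_eq (c : G) (φ ψ : contTwoCocycles Z) :
    (φ - ψ).1 (c, c) + (φ - ψ).1 (1, 1) = (φ.1 (c, c) + φ.1 (1, 1)) - (ψ.1 (c, c) + ψ.1 (1, 1)) := by
  rw [Submodule.coe_sub, ContinuousMap.sub_apply, ContinuousMap.sub_apply]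
  abel

/-- **`H²` of a group of order `≤ 2` has at most one non-zero class when `Z[2]` has at most one non-zero
element and the non-trivial element (if any) acts as `-1`**: two non-zero classes coincide (their invariants are
non-zero `2`-torsion elements of `Z`, hence equal, so the difference has invariant `0`). For `Z = μₙ` this is
`#H²(ℝ, μₙ) ≤ 2` (Milne I Thm. 2.13(a) with `r = 2`). [cite: MilneADT2006, Ch. I, Thm. 2.13] -/
theorem eq_of_ne_zero_of_natCard_le_two [Finite G] (hG : Nat.card G ≤ 2)
    (hZ : ∀ c : G, c ≠ 1 → ∀ z : Z, Z.ρ c z = -z)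
    (h2 : ∀ z z' : Z, 2 • z = 0 → z ≠ 0 → 2 • z' = 0 → z' ≠ 0 → z = z')
    (x y : continuousCohomology 2 Z) (hx : x ≠ 0) (hy : y ≠ 0) : x = y := by
  obtain ⟨φ, rfl⟩ := twoCocycleClass_surjective Z x
  obtain ⟨ψ, rfl⟩ := twoCocycleClass_surjective Z y
  by_cases htriv : ∀ g : G, g = 1
  · exact absurd (twoCocycleClass_eq_zero_of_forall_eq_one htriv φ) hx
  push Not at htriv
  obtain ⟨c, hc⟩ := htriv
  have hφ : φ.1 (c, c) + φ.1 (1, 1) ≠ 0 := fun h ↦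
    hx ((twoCocycleClass_eq_zero_iff_of_natCard_le_two hG hc (hZ c hc) φ).mpr h)
  have hψ : ψ.1 (c, c) + ψ.1 (1, 1) ≠ 0 := fun h ↦
    hy ((twoCocycleClass_eq_zero_iff_of_natCard_le_two hG hc (hZ c hc) ψ).mpr h)
  have heq := h2 _ _ (two_nsmul_add_eq_zero_of_natCard_le_two hG (hZ c hc) φ) hφ
    (two_nsmul_add_eq_zero_of_natCard_le_two hG (hZ c hc) ψ) hψ
  rw [← sub_eq_zero, ← twoCocycleClass_sub, twoCocycleClass_eq_zero_iff_of_natCard_le_two hG hc (hZ c hc),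
    sub_invariant_eq, heq, sub_self]

end OrderTwo

/-! ## §2 `μₙ[2]` has at most one non-zero element; `H²(K_w, μₙ)` has at most one non-zero class -/

section Mu

variable {K : Type u} [Field K] (n : ℕ) [NeZero n]

omit [NeZero n] in
/-- In `μₙ(K̄)` (written additively, `MuCarrier K n`) there is at most one non-zero element killed by `2`: a root of
unity `ζ` with `ζ² = 1` is `±1`. [folklore] -/
theorem muCarrier_eq_of_two_nsmul_eq_zero (z z' : MuCarrier K n) (hz : 2 • z = 0) (hz0 : z ≠ 0)
    (hz' : 2 • z' = 0) (hz'0 : z' ≠ 0) : z = z' := by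
  -- underlying elements of `K̄`
  have key : ∀ x : MuCarrier K n, 2 • x = 0 → x ≠ 0 →
      (((MuCarrier.toAdditive x).toMul : (AlgebraicClosure K)ˣ) : AlgebraicClosure K) = -1 := by
    intro x hx hx0
    have hsq : (((MuCarrier.toAdditive x).toMul : (AlgebraicClosure K)ˣ) : AlgebraicClosure K) *
        (((MuCarrier.toAdditive x).toMul : (AlgebraicClosure K)ˣ) : AlgebraicClosure K) = 1 := by
      have h := muCarrier_eq_iff.mp hx
      rw [two_nsmul, map_add, toMul_add, Subgroup.coe_mul, Units.val_mul, map_zero, toMul_zero,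
        OneMemClass.coe_one, Units.val_one] at h
      exact h
    have hne : (((MuCarrier.toAdditive x).toMul : (AlgebraicClosure K)ˣ) : AlgebraicClosure K) ≠ 1 := by
      intro h1
      apply hx0
      rw [muCarrier_eq_iff, h1, map_zero, toMul_zero, OneMemClass.coe_one, Units.val_one]
    rcases mul_self_eq_one_iff.mp hsq with h | h
    · exact absurd h hne
    · exact h
  rw [muCarrier_eq_iff, key z hz hz0, key z' hz' hz'0]

variable [NumberField K]

/-- **`H²(K_w, μₙ)` has at most one non-zero class** at every infinite place `w` of a number field `K`
(`Γ_{K_w}` has order `≤ 2`, its non-trivial element — if any — inverts the roots of unity; §1). Milne, *ADT*,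
I Thm. 2.13(a) (`r = 2`: `H²(ℝ, μₙ)` is `ℤ/2` or `0`). [cite: MilneADT2006, Ch. I, Thm. 2.13] -/
theorem galoisCohomology_two_mu_inl_eq_of_ne_zero (w : InfinitePlace K)
    (x y : galoisCohomology ((mu K n).toLocal (Sum.inl w)) 2) (hx : x ≠ 0) (hy : y ≠ 0) : x = y := by
  haveI : Finite (absoluteGaloisGroup (Place.Completion (Sum.inl w : Place K))) :=
    finite_absoluteGaloisGroup_completion_infinitePlace w
  haveI : CompactSpace (absoluteGaloisGroup (Place.Completion (Sum.inl w : Place K))) :=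
    absoluteGaloisGroup_compactSpace _
  have hG : Nat.card (absoluteGaloisGroup (Place.Completion (Sum.inl w : Place K))) ≤ 2 :=
    natCard_absoluteGaloisGroup_completion_infinitePlace_le_two w
  refine eq_of_ne_zero_of_natCard_le_two (Z := ((mu K n).toLocal (Sum.inl w)).toTopRep) hG
    (fun c hc z ↦ ?_) (muCarrier_eq_of_two_nsmul_eq_zero n) x y hx hy
  change mu K n (absGaloisRestrict K w.Completion c) z = -z
  exact mu_absGaloisRestrict_eq_neg_infinitePlace w hc z

/-- **An additive map out of `H²(K_w, μₙ)` (`w` an infinite place) is either `0` or injective** — in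
particular the component at `w` of ANY family of local invariant maps. (The class-field-theoretic `inv_w` is the
injective one, Milne I Example 1.6(c); a family given only by `poitouTate_selmerStructure_duality` may a priori have
either.) [cite: MilneADT2006, Ch. I, Example 1.6 (c) and Thm. 2.13] -/
theorem addMonoidHom_galoisCohomology_two_mu_inl_eq_zero_or_injective (w : InfinitePlace K)
    {A : Type*} [AddCommGroup A] (f : galoisCohomology ((mu K n).toLocal (Sum.inl w)) 2 →+ A) :
    f = 0 ∨ Injective f := by
  by_cases h : ∃ x, x ≠ 0 ∧ f x = 0
  · obtain ⟨x, hx, hfx⟩ := h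
    left
    ext y
    by_cases hy : y = 0
    · rw [hy, map_zero, AddMonoidHom.zero_apply]
    · rw [← galoisCohomology_two_mu_inl_eq_of_ne_zero n w x y hx hy, hfx, AddMonoidHom.zero_apply]
  · right
    push Not at h
    exact (injective_iff_map_eq_zero f).mpr fun x hx ↦ by_contra fun hx0 ↦ h x hx0 hx

end Mu

/-! ## §4 The real-place right annihilator of `𝓛_w` -/

section RealPlace

variable {K : Type u} [Field K] [NumberField K] (W : WeierstrassCurve K) [W.IsElliptic] (n : ℕ) [NeZero n]
variable (e : geomTorsion W n → geomTorsion W n → AlgebraicClosure K)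
  (hμ : ∀ S T, e S T ^ n = 1)
  (hadd₁ : ∀ S₁ S₂ T, e (S₁ + S₂) T = e S₁ T * e S₂ T)
  (hadd₂ : ∀ S T₁ T₂, e S (T₁ + T₂) = e S T₁ * e S T₂)
  (hgal : ∀ (σ : absoluteGaloisGroup K) (S T : geomTorsion W n), σ • e S T = e (σ • S) (σ • T))
  (halt : ∀ T, e T T = 1) (hnondeg : ∀ T, (∀ S, e S T = 1) → T = 0)

include halt hnondeg in
/-- **At an infinite place `w` where `inv_w` is injective, the Weil transport of a class in the dual local
condition `𝓛_w^*` lies in `𝓛_w`** (the archimedean twin of the X11b lemma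
`map_weilDualInv_mem_kummer_of_mem_dualLocalCondition`): `⟨a, y⟩_w = inv_w(a ∪ₑ ỹ)`
(`localTatePairingZMod_map_weilDual`), so `inv_w(a ∪ₑ ỹ) = 0` for all `a ∈ 𝓛_w`; by symmetry and injectivity
`ỹ ∪ₑ a = 0`; archimedean local duality (Milne I Thm. 2.13(a), tree
`eq_zero_of_forall_cupProduct_pairing_eq_zero_infinitePlace`) supplies the left kernel for the maximal isotropy
of `𝓛_w` (tree `forall_mem_kummerSelmerStructure_weilCupProduct_eq_zero_iff_inl`, Milne I Lemma 6.15), whence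
`ỹ ∈ 𝓛_w`. [cite: MilneADT2006, Ch. I, Thm. 2.13 and Lemma 6.15] -/
theorem map_weilDualInv_mem_kummer_of_mem_dualLocalCondition_inl [Finite (geomTorsion W n)]
    (inv : LocalInvariants K n) (w : InfinitePlace K) (hinv : Injective (inv (Sum.inl w)))
    {yv : galoisCohomology (((W.torsionGaloisModule n).tateDual n).toLocal (Sum.inl w)) 1}
    (hyv : yv ∈ inv.dualLocalCondition (W.torsionGaloisModule n) (Sum.inl w)
      (W.kummerSelmerStructure (n : ℤ) (Sum.inl w))) :
    galoisCohomology.map ((Summit.BirchSwinnertonDyer.Rank1Residual.X11b.LocBridge.weilDualInv W n e hμ hadd₁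
        hadd₂ hgal hnondeg).restrictField (Place.Completion (Sum.inl w : Place K))) 1 yv ∈
      W.kummerSelmerStructure (n : ℤ) (Sum.inl w) := by
  haveI : CompactSpace (absoluteGaloisGroup (Place.Completion (Sum.inl w : Place K))) :=
    absoluteGaloisGroup_compactSpace _
  haveI : Finite (MuCarrier K n) := Literature.NumberTheory.GaloisRepresentations.finite_muCarrier K n
  set yW : galoisCohomology ((W.torsionGaloisModule n).toLocal (Sum.inl w)) 1 :=
    galoisCohomology.map ((Summit.BirchSwinnertonDyer.Rank1Residual.X11b.LocBridge.weilDualInv W n e hμ hadd₁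
      hadd₂ hgal hnondeg).restrictField (Place.Completion (Sum.inl w : Place K))) 1 yv with hyWdef
  have hw : galoisCohomology.map ((weilDualIntertwining W n e hμ hadd₁ hadd₂ hgal).restrictField
      (Place.Completion (Sum.inl w : Place K))) 1 yW = yv :=
    Summit.BirchSwinnertonDyer.Rank1Residual.X11b.LocBridge.map_weilDual_map_weilDualInv_restrictField W n e hμ
      hadd₁ hadd₂ hgal hnondeg _ yv
  -- `inv_w(a ∪ₑ ỹ) = 0` for every `a ∈ 𝓛_w`
  have hann : ∀ a ∈ W.kummerSelmerStructure (n : ℤ) (Sum.inl w),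
      inv (Sum.inl w) ((weilContPairingLocal W n e hμ hadd₁ hadd₂ hgal (Sum.inl w)).cupProduct a yW) = 0 := by
    intro a ha
    rw [← Summit.BirchSwinnertonDyer.Rank1Residual.X11b.LocBridge.localTatePairingZMod_map_weilDual W n e hμ
      hadd₁ hadd₂ hgal (Sum.inl w) (inv (Sum.inl w)) a yW, hw]
    exact (inv.mem_dualLocalCondition_iff (W.torsionGaloisModule n) (Sum.inl w) _ yv).mp hyv a ha
  -- archimedean local duality: the left kernel of `inv_w(· ∪ₑ ·)` is trivial
  have hA : ∀ a : geomTorsion W n, n • a = 0 := fun a ↦ AddSubgroup.torsionBy.nsmul a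
  have hdual : ∀ x : galoisCohomology ((W.torsionGaloisModule n).toLocal (Sum.inl w)) 1,
      (∀ y, inv (Sum.inl w) ((weilContPairingLocal W n e hμ hadd₁ hadd₂ hgal (Sum.inl w)).cupProduct x y) = 0) →
        x = 0 := by
    intro x hx
    refine eq_zero_of_forall_cupProduct_pairing_eq_zero_infinitePlace (W.torsionGaloisModule n)
      (W.torsionGaloisModule n) hA hA (weilPairingHom W n e hμ hadd₁ hadd₂)
      (weilContPairing W n e hμ hadd₁ hadd₂ hgal).toLin_smul
      (weilPairingHom_injective W n e hμ hadd₁ hadd₂ halt hnondeg)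
      (weilPairingHom_flip_injective W n e hμ hadd₁ hadd₂ hnondeg) w x fun y ↦ ?_
    have h := hx y
    exact hinv (h.trans (map_zero _).symm)
  -- symmetry turns the right-annihilator statement into the left one
  refine (forall_mem_kummerSelmerStructure_weilCupProduct_eq_zero_iff_inl W n e hμ hadd₁ hadd₂ w hgal halt
    (inv (Sum.inl w)) hdual yW).mp fun a ha ↦ ?_
  -- the local Weil cup product is symmetric (graded commutativity for the skew pairing `e`)
  have hsymm : (weilContPairingLocal W n e hμ hadd₁ hadd₂ hgal (Sum.inl w)).cupProduct yW a =
      (weilContPairingLocal W n e hμ hadd₁ hadd₂ hgal (Sum.inl w)).cupProduct a yW := by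
    refine Literature.NumberTheory.EllipticCurves.cupProduct_comm_of_skew _ (fun S T ↦ ?_) yW a
    change weilPairingHom W n e hμ hadd₁ hadd₂ S T = -weilPairingHom W n e hμ hadd₁ hadd₂ T S
    exact weilPairingHom_swap_eq_neg W n e hμ hadd₁ hadd₂ halt T S
  rw [hsymm]
  exact hinv ((hann a ha).trans (map_zero _).symm)

end RealPlace

end Summit.BirchSwinnertonDyer.BirchSwinnertonDyer.Theorems.SignedEC.CasselsPT

end
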